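import Summits.ResolutionOfSingularities.ResolutionOfSingularities.Theorems.RadicialJungCleanModelsWoundLocusClosed
import Summits.ResolutionOfSingularities.ResolutionOfSingularities.Theorems.RadicialJungCleanModelsRegularTypeDerivations
import Literature.AlgebraicGeometry.Resolution.RegularFormallySmoothPrimeField
import Literature.AlgebraicGeometry.Resolution.GiraudLogJacobianIdeal
import HarnessLib

/-!
# [OURS · L W8.1 · T2 brick B2, first half] Giraud's critical set `E(f)` of a global function on a regular variety over a field of
# characteristic `p` is CLOSED, and NOWHERE DENSE when `f` is not a `p`-th power in the function field

Programme `PROGRAMME-clean-dim2` / T2 (res-L0-w81-pv-2 g5, `HOME/L/res-L0-w81-pv-2/g5/T2-ARCHITECTURE.md` §2 B2; coordination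
2026-08-27T19:32:52Z (a)), crux `stmt-ResolutionOfSingularities-0549` line via-clean-models, stub `stub_cleanModels` (= stmt-…-15917);
`--supports … --as helper` by res-L1-s13-pv-1 g7.  OURS glue on tree bricks; nothing here is a statement of H. Hironaka's manuscript;
AI-written, weaker than expert review.

For `X` integral, regular, locally of finite type over a field `k` of characteristic `p` and `f ∈ Γ(X, 𝒪_X)`, Giraud's
`E(f) = derivCriticalSet X f = {ξ : every derivation of 𝒪_{X,ξ} maps the germ of f into 𝔪_ξ}` (tree `GiraudLogJacobianIdeal`, p557089)
coincides with the WOUND LOCUS `{ξ : ∃ c, f_ξ − c^p ∈ 𝔪_ξ²}` of res-L0-w81-pv-1's `RadicialJungCleanModelsWoundLocusClosed` (p544051):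
pointwise this is the boundary-free criterion `forall_derivation_apply_mem_iff_exists_sub_pow_mem_sq` (p545307) on the local ring
`Γ(X, W)_ζ ≅ 𝒪_{X,ξ}` of an affine chart — regular, essentially of finite type over `k`, hence formally smooth over `𝔽_p`
(`formallySmooth_zmod_of_isRegularLocalRing_of_essFiniteType`) —, transported to the stalk along the localisation isomorphism
(derivations and maximal ideals transport along ring isomorphisms; the `∃`-side transport is pv-1's `wound_fromSpec_iff`).  Hence:

* `forall_derivation_apply_mem_of_ringEquiv`, `forall_derivation_apply_mem_iff_of_ringEquiv` — transport of «`D f ∈ 𝔪` for all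
  `D ∈ Der_ℤ`» along a ring isomorphism of local rings (the transported derivation is built inside the proof; the file is def-free);
* `derivJacobianIdeal_le_iff` — `J(O, f) ≤ I ↔ ∀ D, D f ∈ I`;
* `mem_derivCriticalSet_fromSpec_iff` — affine comparison in derivation form; `derivCriticalSet_eq_setOf_exists_sub_pow_mem_sq` —
  **`E(f)` = the wound locus of `f`**;
* **`isClosed_derivCriticalSet`** (hEcl of the T2 skeleton) and **`isNowhereDense_derivCriticalSet`** (hEnd: `f ∉ K(X)^p` ⇒ the generic
  point is not in `E(f)`, pv-1's `genericPoint_not_mem_setOf_wound_stalk`; a closed set of an irreducible space missing the generic point is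
  nowhere dense) — the two hypotheses of `phaseA_of_B2` (`RadicialJungCleanModelsGiraudPhaseA`, p561768).
-/

set_option linter.dupNamespace false -- mandated namespace `Summit.<Summit>.<Problem>` of this single-conjunct summit

noncomputable section

open CategoryTheory AlgebraicGeometry TopologicalSpace Topology IsLocalRing
open Literature.AlgebraicGeometry.Resolution

namespace Summit.ResolutionOfSingularities.ResolutionOfSingularities.Theorems.RadicialJung.CleanModels

/-! ## § 1 Derivations and «all derivations kill `f` modulo `𝔪`» along a ring isomorphism -/

/-- One direction of the transport: if every derivation of `O` maps `f` into `𝔪_O`, then every derivation `D'` of `O' ≅ O` maps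
`e f` into `𝔪_{O'}` — test against the transported derivation `a ↦ e⁻¹(D'(e a))`. [folklore] -/
theorem forall_derivation_apply_mem_of_ringEquiv {O O' : Type*} [CommRing O] [CommRing O'] [IsLocalRing O] [IsLocalRing O']
    (e : O ≃+* O') (f : O) (h : ∀ D : Derivation ℤ O O, D f ∈ maximalIdeal O) (D' : Derivation ℤ O' O') :
    D' (e f) ∈ maximalIdeal O' := by
  -- the transported derivation (no global definition: the file stays def-free)
  let D : Derivation ℤ O O :=
    Derivation.mk' (((e.symm : O' →+* O).toAddMonoidHom.comp
        (D'.toLinearMap.toAddMonoidHom.comp (e : O →+* O').toAddMonoidHom)).toIntLinearMap)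
      (fun a b => by
        change e.symm (D' (e (a * b))) = a • e.symm (D' (e b)) + b • e.symm (D' (e a))
        rw [map_mul, Derivation.leibniz, map_add, smul_eq_mul, smul_eq_mul, map_mul, map_mul, RingEquiv.symm_apply_apply,
          RingEquiv.symm_apply_apply, smul_eq_mul, smul_eq_mul])
  have h1 : e.symm (D' (e f)) ∈ maximalIdeal O := h D
  have h2 : e (e.symm (D' (e f))) ∈ (maximalIdeal O).map e := Ideal.mem_map_of_mem e h1
  rwa [RingEquiv.apply_symm_apply, map_ringEquiv_maximalIdeal] at h2

/-- **«Every derivation maps `f` into `𝔪`» is invariant under isomorphisms of local rings.** [folklore] -/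
theorem forall_derivation_apply_mem_iff_of_ringEquiv {O O' : Type*} [CommRing O] [CommRing O'] [IsLocalRing O] [IsLocalRing O']
    (e : O ≃+* O') (f : O) :
    (∀ D : Derivation ℤ O O, D f ∈ maximalIdeal O) ↔ ∀ D' : Derivation ℤ O' O', D' (e f) ∈ maximalIdeal O' := by
  refine ⟨forall_derivation_apply_mem_of_ringEquiv e f, fun h D => ?_⟩
  have := forall_derivation_apply_mem_of_ringEquiv e.symm (e f) h D
  rwa [RingEquiv.symm_apply_apply] at this

/-- `J(O, f) ≤ I` iff every derivation maps `f` into `I`. [folklore] -/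
theorem derivJacobianIdeal_le_iff {O : Type*} [CommRing O] (f : O) (I : Ideal O) :
    derivJacobianIdeal O f ≤ I ↔ ∀ D : Derivation ℤ O O, D f ∈ I := by
  rw [derivJacobianIdeal, Ideal.span_le, Set.range_subset_iff]
  rfl

/-! ## § 2 Affine comparison in derivation form and `E(f)` = the wound locus -/

section SchemeLevel

variable {k : Type} [Field k]

/-- **Affine comparison, derivation form.** For `X` regular, locally of finite type over a field of characteristic `p`, an affine open
`W`, a prime `ζ` of `Γ(X, W)` and a global section `f`: `fromSpec ζ ∈ E(f)` iff `f|_W ≡ c^p (mod 𝔪²)` in `Γ(X, W)_ζ` for some `c` —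
the boundary-free criterion on the regular, essentially-of-finite-type local ring `Γ(X, W)_ζ ≅ 𝒪_{X, fromSpec ζ}` (formally smooth over
`𝔽_p`). [cite: Giraud1983, Déf. 1.2 (1), Prop. 1.5 (remark p. 114)] -/
theorem mem_derivCriticalSet_fromSpec_iff (p : ℕ) [Fact p.Prime] [CharP k p] {X : Scheme.{0}} [IsIntegral X]
    (q : X ⟶ Spec (.of k)) [LocallyOfFiniteType q]
    (hX : Scheme.IsRegular X) {W : X.Opens} (hW : IsAffineOpen W) (f : Γ(X, ⊤)) (ζ : ↥(Spec Γ(X, W))) :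
    hW.fromSpec ζ ∈ derivCriticalSet X f ↔
      ∃ c : Localization.AtPrime ζ.asIdeal,
        algebraMap Γ(X, W) (Localization.AtPrime ζ.asIdeal) ((X.presheaf.map (homOfLE le_top).op).hom f) - c ^ p ∈
          (maximalIdeal (Localization.AtPrime ζ.asIdeal)) ^ 2 := by
  haveI : IsLocallyNoetherian X := LocallyOfFiniteType.isLocallyNoetherian q
  have hyζ : hW.fromSpec ζ ∈ W := by
    rw [← SetLike.mem_coe, ← hW.range_fromSpec]
    exact ⟨ζ, rfl⟩
  -- the stalk as the localisation of the chart ring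
  letI : Algebra Γ(X, W) (X.presheaf.stalk (hW.fromSpec ζ)) :=
    TopCat.Presheaf.algebra_section_stalk X.presheaf ⟨hW.fromSpec ζ, hyζ⟩
  haveI : IsLocalization.AtPrime (X.presheaf.stalk (hW.fromSpec ζ)) ζ.asIdeal := hW.isLocalization_stalk' ζ hyζ
  let e : X.presheaf.stalk (hW.fromSpec ζ) ≃ₐ[Γ(X, W)] Localization.AtPrime ζ.asIdeal :=
    IsLocalization.algEquiv ζ.asIdeal.primeCompl _ _
  have hf : e ((X.presheaf.germ ⊤ (hW.fromSpec ζ) trivial).hom f) =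
      algebraMap Γ(X, W) (Localization.AtPrime ζ.asIdeal) ((X.presheaf.map (homOfLE le_top).op).hom f) := by
    rw [← e.commutes]
    congr 1
    change _ = (X.presheaf.germ W (hW.fromSpec ζ) hyζ).hom ((X.presheaf.map (homOfLE le_top).op).hom f)
    rw [← CommRingCat.comp_apply, TopCat.Presheaf.germ_res]
  -- the chart ring: regular, of finite type over `k`, characteristic `p`
  let φ : CommRingCat.of k ⟶ Γ(X, W) := (Scheme.ΓSpecIso (.of k)).inv ≫ q.appLE ⊤ W le_top
  letI : Algebra k Γ(X, W) := φ.hom.toAlgebra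
  haveI : Algebra.FiniteType k Γ(X, W) := by
    have h1 : RingHom.FiniteType (q.appLE ⊤ W le_top).hom :=
      HasRingHomProperty.appLE @LocallyOfFiniteType q ‹_› ⟨⊤, isAffineOpen_top _⟩ ⟨W, hW⟩ le_top
    have h2 : RingHom.FiniteType φ.hom := by
      rw [CommRingCat.hom_comp]
      exact h1.comp (RingHom.FiniteType.of_surjective _ (Scheme.ΓSpecIso (.of k)).commRingCatIsoToRingEquiv.symm.surjective)
    exact h2
  haveI : Nonempty W := ⟨⟨_, hyζ⟩⟩
  haveI : CharP Γ(X, W) p := charP_of_injective_algebraMap (algebraMap k Γ(X, W)).injective p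
  haveI : IsRegularRing Γ(X, W) := hX.isRegularRing_of_isAffineOpen hW
  haveI : CharP (Localization.AtPrime ζ.asIdeal) p := charP_localization_atPrime (B := Γ(X, W)) ζ.asIdeal
  letI : Algebra (ZMod p) (Localization.AtPrime ζ.asIdeal) := ZMod.algebra _ p
  haveI : Algebra.FormallySmooth (ZMod p) (Localization.AtPrime ζ.asIdeal) :=
    formallySmooth_zmod_of_isRegularLocalRing_of_essFiniteType p k (Localization.AtPrime ζ.asIdeal)
  -- derivation form at the stalk ↔ derivation form at the localisation ↔ the `∃`-form
  have hf' : e.toRingEquiv ((X.presheaf.germ ⊤ (hW.fromSpec ζ) trivial).hom f) =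
      algebraMap Γ(X, W) (Localization.AtPrime ζ.asIdeal) ((X.presheaf.map (homOfLE le_top).op).hom f) := hf
  change derivJacobianIdeal _ _ ≤ _ ↔ _
  rw [derivJacobianIdeal_le_iff, forall_derivation_apply_mem_iff_of_ringEquiv e.toRingEquiv, hf',
    forall_derivation_apply_mem_iff_exists_sub_pow_mem_sq p]

/-- **`E(f)` is the wound locus of `f`**: for `X` regular, locally of finite type over a field of characteristic `p`,
`derivCriticalSet X f = {ξ | ∃ c : 𝒪_{X,ξ}, f_ξ − c^p ∈ 𝔪_ξ²}`. [cite: Giraud1983, Déf. 1.2 (1), Prop. 1.5 (remark p. 114)] -/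
theorem derivCriticalSet_eq_setOf_exists_sub_pow_mem_sq (p : ℕ) [Fact p.Prime] [CharP k p] {X : Scheme.{0}} [IsIntegral X]
    (q : X ⟶ Spec (.of k)) [LocallyOfFiniteType q] (hX : Scheme.IsRegular X) (f : Γ(X, ⊤)) :
    derivCriticalSet X f = {y : X | ∃ c : X.presheaf.stalk y,
      (X.presheaf.germ ⊤ y trivial).hom f - c ^ p ∈ (maximalIdeal (X.presheaf.stalk y)) ^ 2} := by
  ext y
  obtain ⟨_, ⟨W, hW, rfl⟩, hyW, -⟩ := X.isBasis_affineOpens.exists_subset_of_mem_open (Set.mem_univ y) isOpen_univ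
  have hy : y = hW.fromSpec (hW.primeIdealOf ⟨y, hyW⟩) := (hW.fromSpec_primeIdealOf ⟨y, hyW⟩).symm
  rw [Set.mem_setOf_eq, hy, mem_derivCriticalSet_fromSpec_iff p q hX hW f, wound_fromSpec_iff hW f]

/-- **B2 (first half, a): `E(f)` is CLOSED** for `X` integral, regular, locally of finite type over a field of characteristic `p`.
[cite: Giraud1983, Déf. 1.2 (1) and 2.2 (3)] [cite: Matsumura1987, §30, Cor. to Thm. 30.5] -/
theorem isClosed_derivCriticalSet (p : ℕ) [Fact p.Prime] [CharP k p] {X : Scheme.{0}} [IsIntegral X] (q : X ⟶ Spec (.of k))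
    [LocallyOfFiniteType q] (hX : Scheme.IsRegular X) (f : Γ(X, ⊤)) : IsClosed (derivCriticalSet X f) := by
  rw [derivCriticalSet_eq_setOf_exists_sub_pow_mem_sq p q hX f]
  exact isClosed_setOf_wound_stalk (p := p) q hX f

/-- **B2 (first half, b): `E(f)` is NOWHERE DENSE when `f` is not a `p`-th power in `K(X)`** (`X` integral, regular, locally of finite
type over a field of characteristic `p`): the generic point is not in the closed set `E(f)`. [cite: Giraud1983, 2.2 (3)] -/
theorem isNowhereDense_derivCriticalSet (p : ℕ) [Fact p.Prime] [CharP k p] {X : Scheme.{0}} [IsIntegral X]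
    (q : X ⟶ Spec (.of k)) [LocallyOfFiniteType q] (hX : Scheme.IsRegular X) (f : Γ(X, ⊤))
    (hf : ∀ c : X.functionField, c ^ p ≠ X.presheaf.germ ⊤ (genericPoint X) trivial f) :
    IsNowhereDense (derivCriticalSet X f) := by
  have hcl := isClosed_derivCriticalSet p q hX f
  have hη : genericPoint X ∉ derivCriticalSet X f := by
    rw [derivCriticalSet_eq_setOf_exists_sub_pow_mem_sq p q hX f]
    exact genericPoint_not_mem_setOf_wound_stalk (p := p) f fun c h => hf c h.symm
  unfold IsNowhereDense
  rw [hcl.closure_eq]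
  by_contra hne
  obtain ⟨x, hx⟩ := Set.nonempty_iff_ne_empty.mpr hne
  have hopen : IsOpen (interior (derivCriticalSet X f)) := isOpen_interior
  have hgen : genericPoint X ∈ interior (derivCriticalSet X f) :=
    (genericPoint_spec X).mem_open_set_iff hopen |>.mpr ⟨x, Set.mem_univ _, hx⟩
  exact hη (interior_subset hgen)

end SchemeLevel

end Summit.ResolutionOfSingularities.ResolutionOfSingularities.Theorems.RadicialJung.CleanModels

end
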